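import Summits.CriticalPhenomena.PercolationContinuityZ3.Theorems.PercNearOneGluingNoHeavyQuantBlobWalk
import HarnessLib

/-!
# QUANT lane R8 tool: the VERTEX REDUCTION for the block-comb window inequalities —
# the window functionals are affine in every single gate, so (TW)/(PW) under a `min gate ≥ g` hypothesis
# need only be proved for gate vectors with values in `{g, 1}` (iid blobs interleaved with SURE blobs)

builds on p205010 (kernel theorem, internal audit signed; external expert review pending)

Support file (`--supports stmt-CriticalPhenomena-4575`), QUANT lane lead (gen 11), rung R8 of
`run/shared/lean/prim/quant/LADDER.md`; paper `run/shared/lean/prim/quant/prim-quant-lead-g11/LEAD-NOTES-G11.md` N22.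
Pure real algebra on the explicit cdf recursion `CB[a, p, m]` of `…QuantBlobWalk.lean` (lead g10); no probability space,
no definitions (the same `local notation3`), no sorries, standard axioms.

**Setting** (N21 (0)–(2) of lead g10).  Blobs `k < K` with sizes `a k : ℕ` and independent gates `p k`; `CB[a,p,k] t = P(S_k ≤ t)`;
the OPPORTUNITY window of blob `k` at level `j` is `CB[a,p,k] j − CB[a,p,k] (j − a k)` and its DANGER window (terminal block `c`) is the
same window at level `j − c − T k`, `T k = Σ_{k<i<K} a i`.  The conjectures of record (TW-strong)/(TW-H4)/(PW) (N21 (4), (4′); kit censuses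
j106947, j107110, j107421: 0 violations) assert `Σ_{k<m} danger_k ≤ Σ_{k<m} window_k(j)` (`m ≤ K`) whenever every gate is `≥ g` and a budget
inequality in `g` holds (`(A + c)·g > 2j`, resp. `A·g + c > 2j`); `exchange_of_prefixWindow` turns them into the FAR exchange inequality on block-combs.

**This file (N22 (1)).**  `CB_affine`: for every coordinate `i`, `x ↦ CB[a, p[i ↦ x], m] t` is AFFINE
(`= CB[a,p[i↦0],m] t + x·(CB[a,p[i↦1],m] t − CB[a,p[i↦0],m] t)`) — each `ε_i` enters the law of `S_m` linearly.  Hence every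
prefix window functional `F_m(p) = Σ_{k<m} (window_k(j) − danger_k)` is affine in each gate (`prefixWindow_affine`), so on the gate box
`[g, 1]^K` it is minimised at a VERTEX: `prefixWindow_of_vertices` — if `F_m(q) ≥ 0` for every `q` with `q k ∈ {g, 1}` (`k < K`), then
`F_m(p) ≥ 0` for every `p` with `g ≤ p k ≤ 1` (`k < K`) (induction on the number of non-vertex coordinates; no division).  Since both
budget hypotheses depend on the gates only through `min_k p k ≥ g`, (TW)/(PW) for ARBITRARY gates follow from the case of iid gates `g`
interleaved with SURE blobs (gate `1`); at the all-`g` vertex (TW-strong) is `IndepBlob.far_indepBlob` (`exchange_of_const'`), so the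
whole content of the conjecture is the effect of interleaved sure blobs (N22 (2)–(4): exact normal forms and the exact vertex census
kit j108758).  `exchange_of_vertexWindow` = `exchange_of_prefixWindow` with its hypothesis (PW) replaced by (PW) at the `{g,1}`-vertices.
N21 (4) had recorded 'T is not monotone in individual gates, so no reduction to iid' — correct, but affine suffices for a reduction to
`{g,1}`.  [this work] unless marked [folklore].
-/

noncomputable section

namespace Summit.CriticalPhenomena.PercolationContinuityZ3.Theorems

namespace Quant

namespace BlobWalk

open Finset

/-- `CB[a, p, m] t` = probability that the open mass of the first `m` blobs (sizes `a`, gates `p`) is `≤ t` (the recursion of `…QuantBlobWalk`). -/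
local notation3 "CB[" a ", " p ", " m "]" =>
  (Nat.rec (motive := fun _ => ℤ → ℝ) (fun t => if (0 : ℤ) ≤ t then (1 : ℝ) else 0)
    (fun n f t => (p : ℕ → ℝ) n * f (t - ((a : ℕ → ℕ) n : ℤ)) + (1 - (p : ℕ → ℝ) n) * f t) (m : ℕ))

/-- The prefix window functional `F_m(p) = Σ_{k<m} [(CB[k] j − CB[k](j − a k)) − (CB[k](j − c − T k) − CB[k](j − c − T k − a k))]`,
`T k = Σ_{i ∈ (k, K)} a i`: expected opportunities minus expected dangers among the first `m` blobs of a `K`-blob block-comb. -/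
local notation3 "FW[" a ", " p ", " K ", " j ", " c ", " m "]" =>
  (∑ k ∈ Finset.range (m : ℕ),
    (((Nat.rec (motive := fun _ => ℤ → ℝ) (fun t => if (0 : ℤ) ≤ t then (1 : ℝ) else 0)
        (fun n f t => (p : ℕ → ℝ) n * f (t - ((a : ℕ → ℕ) n : ℤ)) + (1 - (p : ℕ → ℝ) n) * f t) k) (j : ℤ) -
      (Nat.rec (motive := fun _ => ℤ → ℝ) (fun t => if (0 : ℤ) ≤ t then (1 : ℝ) else 0)
        (fun n f t => (p : ℕ → ℝ) n * f (t - ((a : ℕ → ℕ) n : ℤ)) + (1 - (p : ℕ → ℝ) n) * f t) k) ((j : ℤ) - ((a : ℕ → ℕ) k : ℤ))) -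
     ((Nat.rec (motive := fun _ => ℤ → ℝ) (fun t => if (0 : ℤ) ≤ t then (1 : ℝ) else 0)
        (fun n f t => (p : ℕ → ℝ) n * f (t - ((a : ℕ → ℕ) n : ℤ)) + (1 - (p : ℕ → ℝ) n) * f t) k)
          ((j : ℤ) - ((c : ℕ) : ℤ) - ((∑ i ∈ Finset.Ico (k + 1) (K : ℕ), (a : ℕ → ℕ) i : ℕ) : ℤ)) -
      (Nat.rec (motive := fun _ => ℤ → ℝ) (fun t => if (0 : ℤ) ≤ t then (1 : ℝ) else 0)
        (fun n f t => (p : ℕ → ℝ) n * f (t - ((a : ℕ → ℕ) n : ℤ)) + (1 - (p : ℕ → ℝ) n) * f t) k)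
          ((j : ℤ) - ((c : ℕ) : ℤ) - ((∑ i ∈ Finset.Ico (k + 1) (K : ℕ), (a : ℕ → ℕ) i : ℕ) : ℤ) - ((a : ℕ → ℕ) k : ℤ)))))

variable (a : ℕ → ℕ)

/-! ### The cdf recursion is affine in every gate -/

/-- `CB[a, p, m]` depends only on the gates `p k`, `k < m`. [folklore] -/
theorem CB_congr (p q : ℕ → ℝ) (m : ℕ) (h : ∀ k, k < m → p k = q k) : ∀ t : ℤ, CB[a, p, m] t = CB[a, q, m] t := by
  induction m with
  | zero => intro t; rfl
  | succ m ih =>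
    intro t
    rw [CB_succ a p, CB_succ a q, h m (Nat.lt_succ_self m), ih (fun k hk => h k (Nat.lt_succ_of_lt hk)),
      ih (fun k hk => h k (Nat.lt_succ_of_lt hk))]

/-- **Affinity in one gate.**  For every coordinate `i`, level `t` and `m`:
`CB[a, p[i ↦ x], m] t = CB[a, p[i ↦ 0], m] t + x · (CB[a, p[i ↦ 1], m] t − CB[a, p[i ↦ 0], m] t)`. [this work] -/
theorem CB_affine (p : ℕ → ℝ) (i : ℕ) (x : ℝ) (m : ℕ) : ∀ t : ℤ,
    CB[a, Function.update p i x, m] t =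
      CB[a, Function.update p i 0, m] t +
        x * (CB[a, Function.update p i 1, m] t - CB[a, Function.update p i 0, m] t) := by
  induction m with
  | zero => intro t; simp only [CB_zero]; ring
  | succ m ih =>
    intro t
    rw [CB_succ a (Function.update p i x), CB_succ a (Function.update p i 0), CB_succ a (Function.update p i 1)]
    by_cases hmi : m = i
    · subst hmi
      -- below coordinate `m` the three gate vectors agree
      have h0 : ∀ s : ℤ, CB[a, Function.update p m x, m] s = CB[a, Function.update p m 0, m] s :=
        CB_congr a _ _ m fun k hk => by
          rw [Function.update_of_ne (Nat.ne_of_lt hk), Function.update_of_ne (Nat.ne_of_lt hk)]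
      have h1 : ∀ s : ℤ, CB[a, Function.update p m 1, m] s = CB[a, Function.update p m 0, m] s :=
        CB_congr a _ _ m fun k hk => by
          rw [Function.update_of_ne (Nat.ne_of_lt hk), Function.update_of_ne (Nat.ne_of_lt hk)]
      rw [h0, h0, h1, h1, Function.update_self, Function.update_self, Function.update_self]
      ring
    · rw [Function.update_of_ne hmi, Function.update_of_ne hmi, Function.update_of_ne hmi, ih, ih]
      ring

/-! ### The prefix window functional: affinity and the vertex reduction -/

/-- **Affinity of the prefix window functional** in every gate: `F_m(p[i ↦ x]) = F_m(p[i ↦ 0]) + x · (F_m(p[i ↦ 1]) − F_m(p[i ↦ 0]))`.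
[this work] -/
theorem prefixWindow_affine (p : ℕ → ℝ) (i : ℕ) (x : ℝ) (K : ℕ) (j : ℤ) (c m : ℕ) :
    FW[a, Function.update p i x, K, j, c, m] =
      FW[a, Function.update p i 0, K, j, c, m] +
        x * (FW[a, Function.update p i 1, K, j, c, m] - FW[a, Function.update p i 0, K, j, c, m]) := by
  rw [← Finset.sum_sub_distrib, Finset.mul_sum, ← Finset.sum_add_distrib]
  refine Finset.sum_congr rfl fun k _ => ?_
  rw [CB_affine a p i x k, CB_affine a p i x k, CB_affine a p i x k, CB_affine a p i x k]
  ring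

/-- **One-coordinate step.**  If `F_m ≥ 0` at `p[i ↦ g]` and at `p[i ↦ 1]`, then `F_m ≥ 0` at `p[i ↦ x]` for every `x ∈ [g, 1]`
(an affine function on a segment is minimised at an endpoint). [this work] -/
theorem prefixWindow_nonneg_of_endpoints (p : ℕ → ℝ) (i : ℕ) (g x : ℝ) (hgx : g ≤ x) (hx1 : x ≤ 1)
    (K : ℕ) (j : ℤ) (c m : ℕ)
    (hg : 0 ≤ FW[a, Function.update p i g, K, j, c, m]) (h1 : 0 ≤ FW[a, Function.update p i 1, K, j, c, m]) :
    0 ≤ FW[a, Function.update p i x, K, j, c, m] := by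
  rw [prefixWindow_affine a p i x K j c m]
  rw [prefixWindow_affine a p i g K j c m] at hg
  have h1' : FW[a, Function.update p i 1, K, j, c, m] =
      FW[a, Function.update p i 0, K, j, c, m] +
        1 * (FW[a, Function.update p i 1, K, j, c, m] - FW[a, Function.update p i 0, K, j, c, m]) := by ring
  set F0 := FW[a, Function.update p i 0, K, j, c, m]
  set F1 := FW[a, Function.update p i 1, K, j, c, m]
  by_cases hD : 0 ≤ F1 - F0
  · nlinarith [mul_le_mul_of_nonneg_right hgx hD]
  · have hD' : F1 - F0 ≤ 0 := le_of_lt (not_le.1 hD)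
    nlinarith [mul_le_mul_of_nonpos_right hx1 hD']

/-- **VERTEX REDUCTION for the prefix window inequalities.**  Fix sizes `a`, `K`, level `j`, terminal block `c`, a prefix length `m`
and `g`.  If `F_m(q) ≥ 0` for every gate vector `q` with `q k ∈ {g, 1}` for all `k < K`, then `F_m(p) ≥ 0` for every `p` with
`g ≤ p k ≤ 1` for all `k < K`.  (Induction on the number of coordinates `k < K` with `p k ∉ {g, 1}`.) [this work] -/
theorem prefixWindow_of_vertices (g : ℝ) (K : ℕ) (j : ℤ) (c m : ℕ)
    (hV : ∀ q : ℕ → ℝ, (∀ k, k < K → q k = g ∨ q k = 1) → 0 ≤ FW[a, q, K, j, c, m])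
    (p : ℕ → ℝ) (hp : ∀ k, k < K → g ≤ p k ∧ p k ≤ 1) : 0 ≤ FW[a, p, K, j, c, m] := by
  -- induction on the number of non-vertex coordinates below `K`
  suffices H : ∀ n : ℕ, ∀ p : ℕ → ℝ, (∀ k, k < K → g ≤ p k ∧ p k ≤ 1) →
      ((Finset.range K).filter (fun k => p k ≠ g ∧ p k ≠ 1)).card = n → 0 ≤ FW[a, p, K, j, c, m] from
    H _ p hp rfl
  intro n
  induction n with
  | zero =>
    intro p hp hcard
    refine hV p fun k hk => ?_
    have hk' : k ∉ (Finset.range K).filter (fun k => p k ≠ g ∧ p k ≠ 1) := by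
      rw [Finset.card_eq_zero] at hcard
      rw [hcard]; exact Finset.notMem_empty k
    rw [Finset.mem_filter, Finset.mem_range, not_and] at hk'
    have := hk' hk
    by_cases h1 : p k = g
    · exact Or.inl h1
    · exact Or.inr (by by_contra h2; exact this ⟨h1, h2⟩)
  | succ n ih =>
    intro p hp hcard
    -- pick a non-vertex coordinate `i < K`
    have hne : ((Finset.range K).filter (fun k => p k ≠ g ∧ p k ≠ 1)).Nonempty := by
      rw [← Finset.card_pos, hcard]; exact Nat.succ_pos n
    obtain ⟨i, hi⟩ := hne
    rw [Finset.mem_filter, Finset.mem_range] at hi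
    obtain ⟨hiK, hig, hi1⟩ := hi
    -- both endpoint updates have one non-vertex coordinate fewer
    have hcard' : ∀ v : ℝ, (v = g ∨ v = 1) →
        ((Finset.range K).filter (fun k => Function.update p i v k ≠ g ∧ Function.update p i v k ≠ 1)).card = n := by
      intro v hv
      have hset : (Finset.range K).filter (fun k => Function.update p i v k ≠ g ∧ Function.update p i v k ≠ 1) =
          ((Finset.range K).filter (fun k => p k ≠ g ∧ p k ≠ 1)).erase i := by
        ext k
        rw [Finset.mem_erase, Finset.mem_filter, Finset.mem_filter, Finset.mem_range]
        constructor
        · rintro ⟨hkK, hk⟩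
          have hki : k ≠ i := by
            rintro rfl
            rw [Function.update_self] at hk
            rcases hv with hv | hv
            · exact hk.1 hv
            · exact hk.2 hv
          rw [Function.update_of_ne hki] at hk
          exact ⟨hki, hkK, hk⟩
        · rintro ⟨hki, hkK, hk⟩
          refine ⟨hkK, ?_⟩
          rw [Function.update_of_ne hki]
          exact hk
      rw [hset, Finset.card_erase_of_mem (by rw [Finset.mem_filter, Finset.mem_range]; exact ⟨hiK, hig, hi1⟩), hcard]
      rfl
    have hp' : ∀ v : ℝ, (v = g ∨ v = 1) → ∀ k, k < K → g ≤ Function.update p i v k ∧ Function.update p i v k ≤ 1 := by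
      intro v hv k hk
      by_cases hki : k = i
      · subst hki
        rw [Function.update_self]
        rcases hv with hv | hv
        · rw [hv]; exact ⟨le_rfl, (hp k hk).1.trans (hp k hk).2⟩
        · rw [hv]; exact ⟨(hp k hk).1.trans (hp k hk).2, le_rfl⟩
      · rw [Function.update_of_ne hki]; exact hp k hk
    have hg := ih (Function.update p i g) (hp' g (Or.inl rfl)) (hcard' g (Or.inl rfl))
    have h1 := ih (Function.update p i 1) (hp' 1 (Or.inr rfl)) (hcard' 1 (Or.inr rfl))
    have hmain := prefixWindow_nonneg_of_endpoints a p i g (p i) (hp i hiK).1 (hp i hiK).2 K j c m hg h1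
    rwa [Function.update_eq_self] at hmain

/-- **The FAR exchange inequality from the window inequalities AT THE VERTICES** (`exchange_of_prefixWindow` ∘ `prefixWindow_of_vertices`):
for a block-comb with gates `g ≤ p k ≤ 1` (`k < K`), chain weights with `0 ≤ x ≤ w i · p k` (`i ≤ k < K`) and `j − c < A_K`, prefix window
domination at every gate vector with values in `{g, 1}` gives `x · CB[K](j − c) ≤ Σ_{k<K} (w k − x) · p k · window_k(j)`. [this work] -/
theorem exchange_of_vertexWindow (p : ℕ → ℝ) (hp : ∀ k, 0 ≤ p k ∧ p k ≤ 1) (g : ℝ) (K : ℕ) (hpg : ∀ k, k < K → g ≤ p k)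
    (j : ℤ) (c : ℕ) (x : ℝ) (w : ℕ → ℝ)
    (hx : 0 ≤ x) (hwx : ∀ i k, i ≤ k → k < K → x ≤ w i * p k)
    (hA : j - (c : ℤ) < ((∑ k ∈ Finset.range K, a k : ℕ) : ℤ))
    (hV : ∀ q : ℕ → ℝ, (∀ k, k < K → q k = g ∨ q k = 1) → ∀ m, m ≤ K → 0 ≤ FW[a, q, K, j, c, m]) :
    x * CB[a, p, K] (j - (c : ℤ)) ≤
      ∑ k ∈ Finset.range K, (w k - x) * p k * (CB[a, p, k] j - CB[a, p, k] (j - (a k : ℤ))) := by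
  refine exchange_of_prefixWindow a p hp K j c x w hx hwx hA fun m hm => ?_
  have h := prefixWindow_of_vertices a g K j c m (fun q hq => hV q hq m hm) p fun k hk => ⟨hpg k hk, (hp k).2⟩
  rw [← sub_nonneg]
  have e : (∑ k ∈ Finset.range m, (CB[a, p, k] j - CB[a, p, k] (j - (a k : ℤ)))) -
      ∑ k ∈ Finset.range m,
        (CB[a, p, k] (j - (c : ℤ) - ((∑ i ∈ Finset.Ico (k + 1) K, a i : ℕ) : ℤ)) -
          CB[a, p, k] (j - (c : ℤ) - ((∑ i ∈ Finset.Ico (k + 1) K, a i : ℕ) : ℤ) - (a k : ℤ))) =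
      FW[a, p, K, j, c, m] := by
    rw [← Finset.sum_sub_distrib]
  rw [e]; exact h

end BlobWalk

end Quant

end Summit.CriticalPhenomena.PercolationContinuityZ3.Theorems
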